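import Mathlib.GroupTheory.Transfer
import Literature.RepresentationTheory.FiniteGroups.BurnsidePaQbTheorem
import Summits.MatrixMultiplication.OmegaCensus.BoxRatioSectionLawReduction
import Summits.MatrixMultiplication.OmegaCensus.BoxUsefulOddSylowAbelian

/-!
# ω-census, family (b3): conjecture C9 (b) — the NON-SOLVABLE side: simple groups with a prime `≥ 5`, and C9 (b) for ALL finite groups modulo the atoms

HONEST FRAMING (pub-omega census; verbatim): lottery ticket; floor = certified bounds/negative ranges.
Census BOOKKEEPING (conjecture C9 of the cell, STRUCTURE.md §2, `BoxRatioSectionLaw`; pub-omega stpp-1 gen 23).  Nothing here is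
progress on `ω`.

After `BoxRatioSectionLawReduction` the conjecture C9 (b) (`BoxRatioSectionLaw`: a box-useful finite group has centre of index `1, 4, 6`
or carries the `𝒞₂` package) follows from two family statements: (A) the Schmidt atoms `A(p,q)`, `q ≥ 5`, are box-useless in
relation form (`AtomBad p q` — the cell's atom lane, kernel-l4's `atomBad_of_five_le` chain), and (S) every finite non-abelian SIMPLE
group is box-useless.  This file PROVES (S) from (A), classification-free:

* `centralizes_of_centralizes_omega_one` — COPRIME ACTION on an abelian `p`-subgroup `P`: if `y` normalises `P`, `y^r` centralises `P`
  for a prime `r ≠ p`, and `y` centralises every element of `P` of order dividing `p`, then `y` centralises `P` (induction on the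
  exponent: for `v` with `y v^p y⁻¹ = v^p` the element `t = v⁻¹ · y v y⁻¹` has `t^p = 1`, hence is fixed, so `y^j v y^{-j} = v t^j` and
  `t^r = 1 = t^p` forces `t = 1`).  [folklore; Kurzweil–Stellmacher 8.4.3 for the subgroup form]
* **`not_boxUseful_simple_of_prime_ge_five`** — (A) ⇒ every finite non-abelian simple group `S` with a prime `p ≥ 5` dividing `|S|`
  is NOT box-useful.  Proof: a Sylow `p`-subgroup `P` of a box-useful `S` is abelian (`sylow_comm_of_boxUseful`, odd `p`); by
  BURNSIDE'S NORMAL `p`-COMPLEMENT THEOREM (Mathlib `MonoidHom.ker_transferSylow_isComplement'`) and simplicity, `N_S(P)` does not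
  centralise `P` (a normal complement of `P ≠ 1` would be `1`, making `S = P` abelian); so some `g ∈ N_S(P)` acts non-trivially on
  `P`; the least `k₀ > 0` with `g^{k₀} ∈ C_S(P)` is `> 1` and coprime to `p` (`g^{[N_S(P):P]} ∈ P ≤ C_S(P)` and `p ∤ [N_S(P):P]`),
  so for a prime `r ∣ k₀`, `r ≠ p`, the element `y = g^{k₀/r}` has `y^r ∈ C_S(P) ∌ y`; by the coprime-action lemma `y` moves an
  element of `Ω₁(P) = {v ∈ P : v^p = 1}`, and the TRACE LEMMA `exists_atomConfig` produces an `AtomConfig p r a y` inside `S`; now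
  `AtomBad p r` (`atomBad_of_lt_five` for `r ≤ 3` since `p ≥ 5`, hypothesis (A) for `r ≥ 5`) contradicts box-usefulness.
* **`not_boxUseful_simple_of_atomBad_five`** — (A) ⇒ (S): a non-abelian simple group all of whose prime divisors are `≤ 3` would be a
  `{2,3}`-group, solvable by BURNSIDE'S `p^a q^b` THEOREM (tree, PROVED: `Literature.…isSolvable_of_card_eq_prime_pow_mul_prime_pow`),
  and a solvable simple group is abelian (`IsSimpleGroup.comm_iff_isSolvable`).
* **`boxRatioSectionLaw_of_atomBad_five`** — **C9 (b) for EVERY finite group follows from the atom hypothesis (A) alone**; with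
  kernel-l4's `atomBad_of_five_le` (filed 2026-08-27) it becomes unconditional.
-/

namespace Summit.MatrixMultiplication.OmegaCensus

open Subgroup

universe u

/-! ### Coprime action on an abelian `p`-group: fixing `Ω₁` fixes everything -/

section CoprimeAction

variable {G : Type*} [Group G]

/-- If `y` normalises the abelian `p`-subgroup `P`, `y^r` centralises `P` for a prime `r ≠ p`, and `y` centralises every `v ∈ P`
with `v^p = 1`, then `y` centralises `P`. [folklore] -/
theorem centralizes_of_centralizes_omega_one {p r : ℕ} (hp : p.Prime) (hr : r.Prime) (hpr : p ≠ r) (P : Subgroup G)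
    (hPp : IsPGroup p P) (hab : ∀ a ∈ P, ∀ b ∈ P, a * b = b * a) (y : G) (hy : ∀ v ∈ P, y * v * y⁻¹ ∈ P)
    (hyr : ∀ v ∈ P, y ^ r * v * (y ^ r)⁻¹ = v) (h1 : ∀ v ∈ P, v ^ p = 1 → y * v * y⁻¹ = v) :
    ∀ v ∈ P, y * v * y⁻¹ = v := by
  have key : ∀ n : ℕ, ∀ v ∈ P, v ^ (p ^ n) = 1 → y * v * y⁻¹ = v := by
    intro n
    induction n with
    | zero =>
      intro v _ h
      rw [pow_zero, pow_one] at h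
      rw [h, mul_one, mul_inv_cancel]
    | succ n ih =>
      intro v hv hvn
      have hvp : y * v ^ p * y⁻¹ = v ^ p := ih (v ^ p) (P.pow_mem hv p) (by rw [← pow_mul, ← pow_succ']; exact hvn)
      set t := v⁻¹ * (y * v * y⁻¹) with ht
      have htP : t ∈ P := P.mul_mem (P.inv_mem hv) (hy v hv)
      have hc : Commute v⁻¹ (y * v * y⁻¹) := hab _ (P.inv_mem hv) _ (hy v hv)
      have htp : t ^ p = 1 := by
        rw [ht, hc.mul_pow, inv_pow, conj_pow, hvp, inv_mul_cancel]
      have hyt : y * t * y⁻¹ = t := h1 t htP htp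
      have hvt : y * v * y⁻¹ = v * t := by rw [ht, mul_inv_cancel_left]
      have iter : ∀ j : ℕ, y ^ j * v * (y ^ j)⁻¹ = v * t ^ j := by
        intro j
        induction j with
        | zero => simp
        | succ j ihj =>
          have e1 : y ^ (j + 1) * v * (y ^ (j + 1))⁻¹ = y * (y ^ j * v * (y ^ j)⁻¹) * y⁻¹ := by rw [pow_succ']; group
          have e2 : y * (v * t ^ j) * y⁻¹ = (y * v * y⁻¹) * (y * t * y⁻¹) ^ j := by rw [conj_pow]; group
          rw [e1, ihj, e2, hyt, hvt, mul_assoc, ← pow_succ']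
      have htr : t ^ r = 1 := by
        have e := iter r
        rw [hyr v hv] at e
        exact (mul_eq_left.1 e.symm)
      have ht1 : t = 1 := by
        have e : t ^ Nat.gcd p r = 1 := pow_gcd_eq_one.2 ⟨htp, htr⟩
        rwa [Nat.Coprime.gcd_eq_one ((Nat.coprime_primes hp hr).2 hpr), pow_one] at e
      rw [hvt, ht1, mul_one]
  intro v hv
  obtain ⟨n, hn⟩ := hPp ⟨v, hv⟩
  exact key n v hv (by simpa using congrArg Subtype.val hn)

end CoprimeAction

/-! ### Simple groups with a prime `p ≥ 5` -/

section Simple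

variable {S : Type u} [Group S] [Fintype S] [DecidableEq S]

omit [DecidableEq S] in
/-- For `g ∉ C` (a subgroup of a finite group): the least `k₀ > 0` with `g^{k₀} ∈ C` divides every such exponent, and for its least
prime factor `r` the power `y = g^{k₀/r}` satisfies `y ∉ C`, `y^r ∈ C`. [folklore] -/
theorem exists_prime_power_step (C : Subgroup S) (g : S) (hgC : g ∉ C) :
    ∃ (k₀ r : ℕ), 0 < k₀ ∧ g ^ k₀ ∈ C ∧ (∀ k, 0 < k → g ^ k ∈ C → k₀ ∣ k) ∧ r.Prime ∧ r ∣ k₀ ∧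
      g ^ (k₀ / r) ∉ C ∧ (g ^ (k₀ / r)) ^ r ∈ C := by
  classical
  have hex : ∃ k, 0 < k ∧ g ^ k ∈ C := ⟨orderOf g, orderOf_pos g, by rw [pow_orderOf_eq_one]; exact C.one_mem⟩
  let k₀ := Nat.find hex
  have hk₀ : 0 < k₀ ∧ g ^ k₀ ∈ C := Nat.find_spec hex
  have hmin : ∀ k, 0 < k → k < k₀ → g ^ k ∉ C := fun k hk hlt hkC => Nat.find_min hex hlt ⟨hk, hkC⟩
  have hdvd : ∀ k, 0 < k → g ^ k ∈ C → k₀ ∣ k := by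
    intro k hk hkC
    by_contra hnd
    have hmod : 0 < k % k₀ := Nat.pos_of_ne_zero fun h => hnd (Nat.dvd_of_mod_eq_zero h)
    apply hmin (k % k₀) hmod (Nat.mod_lt k hk₀.1)
    have e : g ^ k = (g ^ k₀) ^ (k / k₀) * g ^ (k % k₀) := by
      rw [← pow_mul, ← pow_add, Nat.div_add_mod]
    have : g ^ (k % k₀) = ((g ^ k₀) ^ (k / k₀))⁻¹ * g ^ k := by rw [e, inv_mul_cancel_left]
    rw [this]
    exact C.mul_mem (C.inv_mem (C.pow_mem hk₀.2 _)) hkC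
  have hk1 : k₀ ≠ 1 := by
    intro h
    apply hgC
    have := hk₀.2
    rwa [h, pow_one] at this
  have hrp : (Nat.minFac k₀).Prime := Nat.minFac_prime hk1
  refine ⟨k₀, Nat.minFac k₀, hk₀.1, hk₀.2, hdvd, hrp, Nat.minFac_dvd k₀, ?_, ?_⟩
  · apply hmin
    · exact Nat.div_pos (Nat.minFac_le hk₀.1) hrp.pos
    · exact Nat.div_lt_self hk₀.1 hrp.one_lt
  · rw [← pow_mul, Nat.div_mul_cancel (Nat.minFac_dvd k₀)]
    exact hk₀.2

/-- **(A) ⇒ simple groups with a prime `≥ 5` are box-useless.**  If every `AtomConfig p q` with `p ≠ q` primes, `q ≥ 5`, kills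
box-usefulness, then a finite non-abelian simple group whose order is divisible by a prime `p ≥ 5` is not box-useful.
(Abelian Sylow `p`-subgroup + Burnside's normal `p`-complement theorem + coprime action + the trace lemma.) [folklore] -/
theorem not_boxUseful_simple_of_prime_ge_five
    (hAtom : ∀ p q : ℕ, p.Prime → q.Prime → p ≠ q → 5 ≤ q → AtomBad.{u} p q)
    (hS : IsSimpleGroup S) (hna : ∃ a b : S, a * b ≠ b * a) {p : ℕ} (hp : p.Prime) (hp5 : 5 ≤ p)
    (hpS : p ∣ Fintype.card S) : ¬ BoxUseful S := by
  intro hU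
  classical
  haveI : Fact p.Prime := ⟨hp⟩
  have hodd : Odd p := hp.odd_of_ne_two (by omega)
  obtain ⟨P⟩ : Nonempty (Sylow p S) := inferInstance
  set PS : Subgroup S := (P : Subgroup S) with hPS
  have hPab : ∀ a ∈ PS, ∀ b ∈ PS, a * b = b * a := fun a ha b hb => OddPGroup.sylow_comm_of_boxUseful hodd hU P a b ha hb
  have hPbot : PS ≠ ⊥ := by
    intro h
    have h1 : p ∣ Nat.card PS := P.dvd_card_of_dvd_card (by rwa [Nat.card_eq_fintype_card])
    rw [h, card_bot, Nat.dvd_one] at h1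
    exact hp.one_lt.ne' h1
  have hPtop : PS ≠ ⊤ := by
    rintro h
    obtain ⟨a, b, hab⟩ := hna
    exact hab (hPab a (h ▸ mem_top a) b (h ▸ mem_top b))
  -- the centraliser and normaliser of `P`; `P ≤ C(P)`
  set C : Subgroup S := centralizer (PS : Set S) with hCdef
  have hPC : PS ≤ C := fun v hv => mem_centralizer_iff.2 fun w hw => hPab w hw v hv
  -- Burnside: `N(P) ≤ C(P)` is impossible
  have hNC : ¬ (normalizer (PS : Set S) ≤ C) := by
    intro hle
    have hc := MonoidHom.ker_transferSylow_isComplement' P hle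
    rcases hS.eq_bot_or_eq_top_of_normal (MonoidHom.transferSylow P hle).ker inferInstance with h | h
    · rw [h, isComplement'_bot_left] at hc
      exact hPtop hc
    · rw [h, isComplement'_top_left] at hc
      exact hPbot hc
  obtain ⟨g, hgN, hgC⟩ := SetLike.not_le_iff_exists.1 hNC
  -- a prime step `y = g^{k₀/r}`
  obtain ⟨k₀, r, hk₀, hgk₀, hdvd, hr, hrk₀, hyC, hyrC⟩ := exists_prime_power_step C g hgC
  set y : S := g ^ (k₀ / r) with hydef
  have hyN : y ∈ normalizer (PS : Set S) := (normalizer (PS : Set S)).pow_mem hgN _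
  -- `p ∤ k₀`: `g^{[N(P):P]} ∈ P ≤ C(P)` and `p ∤ [N(P):P]`
  have hrp : p ≠ r := by
    intro hpr
    let N := normalizer (PS : Set S)
    let P' : Subgroup N := PS.subgroupOf N
    have hidx : g ^ P'.index ∈ C := by
      have h1 : ((QuotientGroup.mk (⟨g, hgN⟩ : N) : N ⧸ P') ^ P'.index) = 1 := by
        rw [Subgroup.index]; exact pow_card_eq_one'
      rw [← QuotientGroup.mk_pow, QuotientGroup.eq_one_iff, mem_subgroupOf] at h1
      exact hPC (by simpa using h1)
    have hPidx : ¬ p ∣ P'.index := by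
      have hd : P'.index ∣ PS.index := relIndex_dvd_index_of_le le_normalizer
      exact fun h => P.not_dvd_index (h.trans hd)
    have hpos : 0 < P'.index := Nat.pos_of_ne_zero (FiniteIndex.index_ne_zero)
    exact hPidx (hpr ▸ hrk₀ |>.trans (hdvd _ hpos hidx))
  -- `y` acts on `P` and on `Ω₁(P)`
  have hyP : ∀ v ∈ PS, y * v * y⁻¹ ∈ PS := fun v hv => (mem_normalizer_iff.1 hyN v).1 hv
  have hyrP : ∀ v ∈ PS, y ^ r * v * (y ^ r)⁻¹ = v := by
    intro v hv
    have := (mem_centralizer_iff.1 hyrC) v hv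
    rw [mul_inv_eq_iff_eq_mul, this]
  let V : Subgroup S :=
    { carrier := {v | v ∈ PS ∧ v ^ p = 1}
      mul_mem' := by
        rintro a b ⟨ha, hap⟩ ⟨hb, hbp⟩
        refine ⟨PS.mul_mem ha hb, ?_⟩
        have hc : Commute a b := hPab a ha b hb
        rw [hc.mul_pow, hap, hbp, one_mul]
      one_mem' := ⟨PS.one_mem, one_pow p⟩
      inv_mem' := by
        rintro a ⟨ha, hap⟩
        exact ⟨PS.inv_mem ha, by rw [inv_pow, hap, inv_one]⟩ }
  have hVmem : ∀ v, v ∈ V ↔ v ∈ PS ∧ v ^ p = 1 := fun v => Iff.rfl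
  have hVab : ∀ v ∈ V, ∀ w ∈ V, v * w = w * v := fun v hv w hw => hPab v ((hVmem v).1 hv).1 w ((hVmem w).1 hw).1
  have hVp : ∀ v ∈ V, v ^ p = 1 := fun v hv => ((hVmem v).1 hv).2
  have hyV : ∀ v ∈ V, y * v * y⁻¹ ∈ V := by
    intro v hv
    obtain ⟨hvP, hvp⟩ := (hVmem v).1 hv
    exact (hVmem _).2 ⟨hyP v hvP, by rw [conj_pow, hvp, mul_one, mul_inv_cancel]⟩
  have hyqV : ∀ v ∈ V, y ^ r * v * (y ^ r)⁻¹ = v := fun v hv => hyrP v ((hVmem v).1 hv).1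
  have hmove : ∃ v ∈ V, y * v * y⁻¹ ≠ v := by
    by_contra hno
    push Not at hno
    apply hyC
    refine mem_centralizer_iff.2 fun v hv => ?_
    have := centralizes_of_centralizes_omega_one hp hr hrp PS P.isPGroup' hPab y hyP hyrP
      (fun v hv hvp => hno v ((hVmem v).2 ⟨hv, hvp⟩)) v hv
    rw [mul_inv_eq_iff_eq_mul] at this
    exact this.symm
  -- the atom configuration inside `S`
  obtain ⟨a, -, hconf⟩ := exists_atomConfig (V := V) hVab hVp hyV hmove hyqV
  have hbad : AtomBad.{u} p r := by
    by_cases hr5 : 5 ≤ r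
    · exact hAtom p r hp hr hrp hr5
    · exact atomBad_of_lt_five hp hr hrp (Or.inl hp5) (not_le.1 hr5)
  exact hbad S a y hconf hU

/-- **(A) ⇒ (S): every finite non-abelian simple group is box-useless.**  The primes `≥ 5` case is the previous theorem; a simple
group with no prime divisor `≥ 5` is a `{2,3}`-group, solvable by Burnside's `p^a q^b` theorem (tree, proved), hence abelian —
excluded. [folklore] -/
theorem not_boxUseful_simple_of_atomBad_five
    (hAtom : ∀ p q : ℕ, p.Prime → q.Prime → p ≠ q → 5 ≤ q → AtomBad.{0} p q)
    (S : Type) [Group S] [Fintype S] [DecidableEq S] (hS : IsSimpleGroup S) (hna : ∃ a b : S, a * b ≠ b * a) :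
    ¬ BoxUseful S := by
  classical
  by_cases h5 : ∃ p : ℕ, p.Prime ∧ 5 ≤ p ∧ p ∣ Fintype.card S
  · obtain ⟨p, hp, hp5, hpS⟩ := h5
    exact not_boxUseful_simple_of_prime_ge_five hAtom hS hna hp hp5 hpS
  · push Not at h5
    exfalso
    -- `|S| = 2^a 3^b`
    have hfac : ∃ a b : ℕ, Fintype.card S = 2 ^ a * 3 ^ b := by
      have key : ∀ n : ℕ, 0 < n → (∀ p : ℕ, p.Prime → p ∣ n → p = 2 ∨ p = 3) → ∃ a b : ℕ, n = 2 ^ a * 3 ^ b := by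
        intro n
        induction n using Nat.strong_induction_on with
        | _ n ih =>
          intro hn hprimes
          by_cases h1 : n = 1
          · exact ⟨0, 0, by rw [h1]; norm_num⟩
          · obtain ⟨q, hq, hqn⟩ := Nat.exists_prime_and_dvd h1
            obtain ⟨m, rfl⟩ := hqn
            have hm : 0 < m := Nat.pos_of_mul_pos_left hn
            have hmlt : m < q * m := lt_mul_left hm hq.one_lt
            obtain ⟨a, b, hab⟩ := ih m hmlt hm (fun p' hp' hd => hprimes p' hp' (hd.mul_left q))
            rcases hprimes q hq (dvd_mul_right q m) with rfl | rfl
            · exact ⟨a + 1, b, by rw [hab]; ring⟩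
            · exact ⟨a, b + 1, by rw [hab]; ring⟩
      refine key _ Fintype.card_pos fun q hq hqd => ?_
      have hlt : q < 5 := not_le.1 fun h => h5 q hq h hqd
      interval_cases q <;> first | (left; rfl) | (right; rfl) | exact absurd hq (by decide)
    obtain ⟨a, b, hab⟩ := hfac
    haveI : IsSimpleGroup S := hS
    have hsolv : IsSolvable S :=
      Literature.RepresentationTheory.FiniteGroups.isSolvable_of_card_eq_prime_pow_mul_prime_pow Nat.prime_two
        Nat.prime_three (a := a) (b := b) (by rw [Nat.card_eq_fintype_card, hab])
    obtain ⟨x, z, hxz⟩ := hna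
    exact hxz ((IsSimpleGroup.comm_iff_isSolvable.2 hsolv) x z)

/-- **C9 (b) for EVERY finite group, modulo the atoms.**  If every finite group carrying an `AtomConfig p q` with `p ≠ q` primes
and `q ≥ 5` is box-useless (the atom hypothesis (A) — kernel-l4's `atomBad_of_five_le`), then `BoxRatioSectionLaw` holds: a
box-useful finite group has centre of index `1`, `4` or `6`, or carries the `𝒞₂` package. [folklore] -/
theorem boxRatioSectionLaw_of_atomBad_five
    (hAtom : ∀ p q : ℕ, p.Prime → q.Prime → p ≠ q → 5 ≤ q → AtomBad.{0} p q) : BoxRatioSectionLaw :=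
  boxRatioSectionLaw_of_atomBad_five_of_simple hAtom
    (fun S _ _ _ hS hna => not_boxUseful_simple_of_atomBad_five hAtom S hS hna)

end Simple

end Summit.MatrixMultiplication.OmegaCensus
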